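import Summits.BirchSwinnertonDyer.BirchSwinnertonDyer.Theorems.AdditiveBranchIMCGordTwoRankOneHeegnerKolyvaginManinIstar
import Summits.BirchSwinnertonDyer.BirchSwinnertonDyer.Theorems.AdditiveBranchIMCGordTwoRankOneHeegnerKolyvaginSmallImage
import Literature.NumberTheory.EllipticCurves.KolyvaginShaStructure
import HarnessLib

/-!
# Route `AdditiveBranchIMC` (rung K1), crux `GordTwoRankOne` (item 19358): the Heegner–Kolyvagin road,
# Part 20 — the certificate road EXTENDED TO THE SMALL-IMAGE rows (`E[p]` irreducible, `ρ̄_{E,p^n}` not onto):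
# STEP L′ there from ONE prime-level Kolyvagin certificate via Matar–Nekovář 2019 (Kolyvagin's structure theorem
# under IRREDUCIBILITY), at Part 18a's Manin-good frames; the crux BY NAME with the displayed complement shrunk
# to the REDUCIBLE rows and the `p ∣ ∏c` small-image corner
# (cell `bsd-addord`, second prover lane `bsd-addord-k1-c3x`, gen 4; `--supports` only)

HONEST FRAMING. THEOREMS ONLY: no definition, no new named fact, no `sorry`; nothing is booked; crux 19358 stays
OPEN at class level; BSD is not proved by any of this. The certificate hypotheses (`hCertW`, `hCert`, `hPCert`) and
Conjecture A (`hA`, `hAsm`) are DISPLAYED inputs, never asserted.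

WHY. Parts 17d/18a give the crux's LOWER half on the TOWER-SURJECTIVE rows from PUB + BSD-depth Kolyvagin
certificates, and gen 2's Part 14 gives it on the SMALL-IMAGE rows (`E[p]` irreducible, `ρ̄_{E,p^n}` not onto for
some `n`: the O8 rows at `p ≥ 5`, the 3-adic tower defects) from PUB + STEP L′ there (`hLsm`, displayed) +
Coates–Sujatha's Conjecture A at the twist (Kato's bound for irreducible `E[p]`, `hKatoI`). The certificate doors
of 17a/17d need `ρ̄_{E,p^m}` onto (McCallum's fact). But Kolyvagin's structure theorem in the `M_∞ = 0`, PRIME-LEVEL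
form is in the tree for IRREDUCIBLE `ρ̄_{E,p}` with NO reduction hypothesis at `p`: Matar–Nekovář 2019 Thm. 0.7 /
§0.11 (`MatarNekovar2019_card_sha_primary_baseChange_of_derivedPoint_not_divisible_of_irreducible`, `hMN`: `W` non-CM,
`d_K ∉ {−3,−4}`, `p` odd, ONE Kolyvagin prime `ℓ` with `P_ℓ ∉ pE(K_ℓ)`, `p^{M₀} ∥ y_K` ⟹ `#Ш(E/K)[p^∞] = p^{2M₀}`).
HENCE (this file): §35 `adjustedIndexBound_of_primeCertificate_of_matarNekovar` — at such a frame STEP L′ (indeed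
`2·ord_p[E(K):ℤP] = ord_p #Ш(E/K)`); §36 the pointwise LOWER half on a small-image additive potentially good row
from PUB (`hPub`, `hKatoI`, `hMN`) + a datum with `p ∤ c` (Part 18a: `Irr` suffices) + a prime-level certificate at
the odd Manin-good frames with `d_K < −4` (`hCertW`) + Conjecture A at the twists (`hA`), and the class-level form on
the small-image rows of cell (G-ord, `e = 2`) with `p ∤ ∏c_ℓ(E)` at EVERY odd `p` (cite-only `hMz hAU hC2` for the
datum; where `p ∣ ∏c` BSD predicts `M_∞ = ord_p ∏c > 0` — Jetchev — and the tree has no depth-`M` structure theorem for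
irreducible image at an additive `p`, Cha 2005 needing `p² ∤ N`, so those rows stay displayed); §37 the crux BY NAME:
CM → Li–Liu–Tian; tower-surjective → Part 18a §31 (BSD-depth certificates); small image with `p ∤ ∏c` → §36; DISPLAYED:
the non-CM rows that are REDUCIBLE, or small-image with `p ∣ ∏c_ℓ(E)`. NET: on every irreducible row of the cell off
that corner, 19358 ⟸ PUB + [a Kolyvagin certificate of the BSD-predicted depth at an odd Manin-good frame]
(+ Conjecture A at the twist off the tower-surjective rows); no STEP L′, no Manin item, no Λ-adic object.

References: [MatarNekovar2019] Thm. 0.7, §0.9, §0.11, Prop. 5.26; [MatarNekovar2021Correction]; [McCallumLMS1991]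
§5 Lemma 5.1, Cor. 5.6; [GrossLMS1991] §4; [JetchevSkinnerWan2017] §7.4.1; [Kato2004Asterisque] Thm. 14.5 (3),
Prop. 14.16 (2); [CoatesSujatha2005] (A); [Darmon2004] Thm. 3.6; [HoffsteinLuo1997] §1; [EdixhovenManin1991] §1;
[Mazur1978] Cor. 4.1; [AbbesUllmo1996] Thm. A; [LiLiuTian2024] Thm. 1.1; [Miller2011LMS] Def. 1.1.
-/

set_option autoImplicit false
set_option linter.dupNamespace false
noncomputable section
open scoped Classical NumberField
open WeierstrassCurve NumberField IsDedekindDomain Literature.NumberTheory.EllipticCurves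
  Literature.NumberTheory.EllipticCurves.ModularForms Literature.NumberTheory.EllipticCurves.Rank1Residual
  Literature.NumberTheory.EllipticCurves.Rank1Residual.Typed Literature.NumberTheory.Automorphic
  Summit.BirchSwinnertonDyer.Rank1Residual Summit.BirchSwinnertonDyer.Rank1Residual.Additive
  Summit.BirchSwinnertonDyer.Rank1Residual.X11b Summit.BirchSwinnertonDyer.Rank1Residual.GaloisImage
  Summit.BirchSwinnertonDyer.BirchSwinnertonDyer.Theses.AdditiveKolyvaginRoad
  Summit.BirchSwinnertonDyer.BirchSwinnertonDyer.Theorems.AdditiveKolyvaginKernel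

namespace Summit.BirchSwinnertonDyer.BirchSwinnertonDyer.Theorems.AdditiveBranchIMCGordTwoRankOne.HeegnerKolyvagin

/-! ### §35 STEP L′ at a frame from ONE prime-level Kolyvagin certificate, for IRREDUCIBLE `ρ̄_{E,p}` (Matar–Nekovář) -/

/-- **STEP L′ at a datum from ONE prime-level certificate, IRREDUCIBLE image** — the Matar–Nekovář twin of
Part 17a's `adjustedIndexBound_of_kolyvaginClass_ne_zero_of_mccallum` (there: tower-surjective, McCallum). Frame of
the cited fact (`hMN`): `W/ℚ` globally minimal non-CM, `K` imaginary quadratic Heegner for `N_E` with `d_K ∉ {−3,−4}`,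
`p` odd with `E[p]` IRREDUCIBLE, the conductor-`1` datum `d₁` with `P_1 = y_K = P ∈ E(K)` of infinite order, `E(K)` of
rank one without `p`-torsion, `Ш(E/K)` finite, `p^{M₀} ∥ P`. CERTIFICATE: ONE Kolyvagin prime `ℓ` and a datum `d` of
conductor `ℓ` with `P_ℓ ∉ pE(K_ℓ)`. Then `#Ш(E/K)[p^∞] = p^{2M₀}` (the fact) and `ord_p[E(K):ℤP] = M₀` (McCallum Lemma
5.1, x11b's `padicValNat_index_zmultiples_eq_of_divisibility`), so `2·ord_p[E(K):ℤP] = ord_p #Ш(E/K) ≤` the ADJUSTED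
right-hand side for ANY `Wd`. CONDITIONAL on `hMN`. [cite: MatarNekovar2019, Thm. 0.7 and §0.11 (pp. 456–457)]
[cite: McCallumLMS1991, §5 Lemma 5.1 (p. 303) and Cor. 5.6 (p. 310)] [cite: JetchevSkinnerWan2017, §7.4.1 (pp. 30–31)] -/
theorem adjustedIndexBound_of_primeCertificate_of_matarNekovar
    (hMN : MatarNekovar2019_card_sha_primary_baseChange_of_derivedPoint_not_divisible_of_irreducible)
    (W : WeierstrassCurve ℚ) [W.IsElliptic] [W.IsGloballyMinimal] [NeZero (W.conductorNorm ℤ)]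
    (hCM : ¬ W.HasCM) (K : Type) [Field K] [NumberField K] (hK : IsImaginaryQuadratic K)
    (h3 : NumberField.discr K ≠ -3) (h4 : NumberField.discr K ≠ -4)
    (hH : SatisfiesHeegnerHypothesis (W.conductorNorm ℤ) K)
    (p : ℕ) [Fact p.Prime] (hp2 : p ≠ 2) (hirr : W.HasIrreducibleModPGaloisRep p)
    (Dt : ModularParametrizationData W (W.conductorNorm ℤ)) (β : ℤ) (ι : K →+* ℂ)
    (d₁ : KolyvaginHeegnerData Dt β ι 1) (P : (W.baseChange K).toAffine.Point)
    (hPd : d₁.toGeomPoints d₁.derivedPoint = toGeomPoints (W.baseChange K) P)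
    (hPinf : ¬ IsOfFinAddOrder P)
    (hrank : (W.baseChange K).mordellWeilRank = 1)
    (hiv : ∀ x : (W.baseChange K).toAffine.Point, p • x = 0 → x = 0)
    [Finite (W.baseChange K).sha] {M₀ : ℕ}
    (hdiv : ∃ Q : (W.baseChange K).toAffine.Point, ((p ^ M₀ : ℕ) : ℤ) • Q = P)
    (hndiv : ¬ ∃ Q : (W.baseChange K).toAffine.Point, ((p ^ (M₀ + 1) : ℕ) : ℤ) • Q = P)
    {ℓ : ℕ} (d : KolyvaginHeegnerData Dt β ι ℓ) (hℓ : Zhang2014.IsKolyvaginPrime (W.conductorNorm ℤ) W K p ℓ)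
    (hcert : ¬ ∃ Q : (W.baseChange (ringClassField K ι ℓ)).toAffine.Point, (p : ℤ) • Q = d.derivedPoint)
    (Wd : WeierstrassCurve ℚ) :
    (2 * padicValNat p (AddSubgroup.zmultiples P).index : ℤ) ≤
      padicValNat p (W.baseChange K).shaOrder + padicValNat p W.tamagawaProduct +
        padicValNat p Wd.tamagawaProduct + 2 * padicValRat p (Dt.c : ℚ) := by
  -- Kolyvagin's structure theorem under irreducibility, `M_∞ = 0` at prime level: `#Ш(E/K)[p^∞] = p^{2M₀}`
  have hcard : Nat.card (AddCommGroup.primaryComponent (W.baseChange K).sha p) = p ^ (2 * M₀) :=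
    hMN W hCM K hK h3 h4 hH p hp2 hirr Dt β ι d₁ P hPd hPinf M₀ hdiv hndiv ℓ d hℓ hcert
  have hp : p.Prime := Fact.out
  have hsha : padicValNat p (W.baseChange K).shaOrder =
      padicValNat p (Nat.card (AddCommGroup.primaryComponent (W.baseChange K).sha p)) :=
    Three.Koly.padicValNat_shaOrder_eq (W.baseChange K) p
  have hval : padicValNat p (W.baseChange K).shaOrder = 2 * M₀ := by
    rw [hsha, hcard, padicValNat.prime_pow]
  -- McCallum Lemma 5.1: `ord_p[E(K):ℤP] = M₀`
  haveI : Finite (AddCommGroup.torsion (W.baseChange K).toAffine.Point) :=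
    WeierstrassCurve.finite_torsion_point (W := W.baseChange K)
  obtain ⟨c, Q, hcQ, hcker⟩ := RankOne.exists_coord_of_mordellWeilRank_eq_one (W.baseChange K) hrank
  have hidx : padicValNat p (AddSubgroup.zmultiples P).index = M₀ :=
    Three.Koly.padicValNat_index_zmultiples_eq_of_divisibility c Q hcQ hcker hiv P hdiv hndiv
  have e3 : (0 : ℤ) ≤ padicValRat p (Dt.c : ℚ) := by rw [padicValRat.of_int]; positivity
  have e4 : (0 : ℤ) ≤ (padicValNat p W.tamagawaProduct : ℤ) + padicValNat p Wd.tamagawaProduct := by positivity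
  have e5 : ((2 * M₀ : ℕ) : ℤ) = 2 * (M₀ : ℤ) := by norm_cast
  rw [hidx, hval, e5]
  linarith

/-! ### §36 The LOWER half on the SMALL-IMAGE rows from prime-level certificates + Conjecture A at the twist -/

/-- **THE HORIZONTAL KERNEL FOR THE LOWER HALF ON A SMALL-IMAGE ROW (one pair), every ODD `p`.** `W/ℚ` globally
minimal NON-CM, `p` odd ADDITIVE and potentially good (`0 ≤ ord_p j`), `r_an = 1`, `E[p]` IRREDUCIBLE (any image
size). PUBLISHED inputs: the sibling route's conjunction `PublishedInputsAdditiveKoly` (`hPub`: Gross–Zagier,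
Kolyvagin, GZK, modularity, newforms, Hoffstein–Luo, Shimura reciprocity at conductor `1`, Darmon 3.6, …), Kato
14.5 (3) for irreducible `E[p]` in the fine-Selmer reading (`hKatoI`), Matar–Nekovář (`hMN`); a datum with `p ∤ c`
(`hD` — on cell (G-ord, `e = 2`) Part 18a supplies it from `Irr`). DISPLAYED inputs: `hCertW` — at every odd
Manin-good frame `(K, Dt, β, ι)` of THIS curve with `d_K < −4`, ONE Kolyvagin prime `ℓ` and a datum of conductor `ℓ`
whose derived point is not `p`-divisible in `E(K_ℓ)` (Kolyvagin's conjecture mod `p` at prime level — the value BSD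
predicts at such a frame when `p ∤ ∏c_ℓ(E)` — the
class-level forms below ask it ONLY on those rows); `hA` — Coates–Sujatha's Conjecture A for the minimal twist
models at the Heegner fields of this curve. CONCLUSION: `Typed.MissingLowerBoundAt W p` (frame as in Part 17b's kernel; §35; gen 2's
Part 14 door `missingLowerBoundAt_rankOne_additive_of_adjustedIndexBound_of_irr`).
[cite: MatarNekovar2019, Thm. 0.7 and §0.11 (pp. 456–457)] [cite: McCallumLMS1991, §5 Lemma 5.1 and Cor. 5.6]
[cite: Kato2004Asterisque, Thm. 14.5 (3) (p. 236) and Prop. 14.16 (2)] [cite: CoatesSujatha2005, statement (A)]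
[cite: Darmon2004, Thm. 3.6] [cite: JetchevSkinnerWan2017, §7.4.1 (pp. 29–31)] -/
theorem missingLowerBoundAt_rankOne_additive_potGood_irr_of_primeCertificate
    (hPub : PublishedInputsAdditiveKoly)
    (hKatoI : Kato2004.rankZero_padicValNat_sha_add_padicValNat_tamagawa_le_of_additive_potGood_of_irreducible_of_fineSelmerDual_fg)
    (hMN : MatarNekovar2019_card_sha_primary_baseChange_of_derivedPoint_not_divisible_of_irreducible)
    (W : WeierstrassCurve ℚ) [W.IsElliptic] [W.IsGloballyMinimal] [NeZero (W.conductorNorm ℤ)]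
    (p : ℕ) [Fact p.Prime] (hCM : ¬ W.HasCM) (hp2 : p ≠ 2) (hadd : Addv W p)
    (hj : 0 ≤ padicValRat p W.j) (hr : W.analyticRank = 1) (hirr : W.HasIrreducibleModPGaloisRep p)
    (hD : ∃ Dt : ModularParametrizationData W (W.conductorNorm ℤ), ¬ (p : ℤ) ∣ Dt.c)
    (hCertW : ∀ (K : Type) [Field K] [NumberField K]
      (Dt : ModularParametrizationData W (W.conductorNorm ℤ)) (β : ℤ) (ι : K →+* ℂ),
      IsImaginaryQuadratic K → Odd (NumberField.discr K) → NumberField.discr K < -4 →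
      SatisfiesHeegnerHypothesis (W.conductorNorm ℤ) K →
      (W.quadraticTwist (NumberField.discr K : ℚ)).entireLFunction 1 ≠ 0 →
      (4 * (W.conductorNorm ℤ : ℤ)) ∣ β ^ 2 - NumberField.discr K → ¬ (p : ℤ) ∣ Dt.c →
      ∃ (ℓ : ℕ) (d : KolyvaginHeegnerData Dt β ι ℓ), Zhang2014.IsKolyvaginPrime (W.conductorNorm ℤ) W K p ℓ ∧
        ¬ ∃ Q : (W.baseChange (ringClassField K ι ℓ)).toAffine.Point, (p : ℤ) • Q = d.derivedPoint)
    (hA : ∀ (K : Type) [Field K] [NumberField K]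
      (Wd : WeierstrassCurve ℚ) [Wd.IsElliptic] [Wd.IsGloballyMinimal] (Cd : VariableChange ℚ),
      IsImaginaryQuadratic K → SatisfiesHeegnerHypothesis (W.conductorNorm ℤ) K →
      (W.quadraticTwist (NumberField.discr K : ℚ)).entireLFunction 1 ≠ 0 →
      Cd • W.quadraticTwist (NumberField.discr K : ℚ) = Wd →
      ∀ κ : ZpExtension ℚ p, κ.IsCyclotomic →
        ∃ (γ : Field.absoluteGaloisGroup ℚ) (D : Wd.FineSelmerDualData κ γ),
          Module.Finite ℤ_[p] (RestrictScalars ℤ_[p] (IwasawaAlgebra p) D.X)) :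
    Typed.MissingLowerBoundAt W p := by
  obtain ⟨hGZ, hKo, -, hGZK, hmod, hnf, hHL, hrec, -, h36⟩ := hPub
  have hp : p.Prime := Fact.out
  -- the odd Hoffstein–Luo frame with `d_K < -4` on the datum with `p ∤ c`, Darmon's datum, Kolyvagin, no `p`-torsion
  obtain ⟨K, _, _, Dt, H, ι, P, Wd, _, _, Cd, hK, hodd, hlt, hpd, hHN, hP, hc, hμ, hLt, hWd⟩ :=
    exists_oddHeegnerFrame_lt_of_exists_not_dvd hnf hHL W p hr hp2 hD
  have h3 : NumberField.discr K ≠ -3 := by omega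
  have h4 : NumberField.discr K ≠ -4 := by omega
  obtain ⟨d₁⟩ := kolyvaginRoadThree_hKD_of_darmon36 h36 W K Dt H.β ι hK hHN H.dvd_sq_sub
  have hPd : d₁.toGeomPoints d₁.derivedPoint = toGeomPoints (W.baseChange K) P :=
    KolyvaginBottom.toGeomPoints_derivedPoint_one_eq (hrec _ W K) hK hHN hP d₁ rfl
  have hPinf : ¬ IsOfFinAddOrder P :=
    not_isOfFinAddOrder_of_heegner_of_analyticRank_eq_one W (W.conductorNorm ℤ) K Dt H ι P (hGZ _ W K)
      hmod hr hK hHN hLt hP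
  obtain ⟨hrank, hSha⟩ := hKo (W.conductorNorm ℤ) W K hK hHN ⟨Dt, H, ι, hP⟩ hPinf
  haveI : Finite (W.baseChange K).sha := hSha
  have hbot := torsionBy_eq_bot_of_isImaginaryQuadratic_of_hasIrreducibleModPGaloisRep W K hK hp hirr
  have hiv : ∀ x : (W.baseChange K).toAffine.Point, p • x = 0 → x = 0 := fun x hx ↦ by
    have hmem : x ∈ AddSubgroup.torsionBy (W.baseChange K).toAffine.Point ((p : ℕ) : ℤ) := by
      rw [mem_torsionBy_iff, natCast_zsmul]
      exact hx
    rw [hbot] at hmem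
    exact hmem
  haveI : Module.Finite ℤ (W.baseChange K).toAffine.Point := (W.baseChange K).module_finite_point_holds
  obtain ⟨M₀, x₀, hx₀, hmax⟩ := exists_pow_smul_eq_and_forall_ne hPinf (p := p) hp.two_le
  have hdiv : ∃ Q : (W.baseChange K).toAffine.Point, ((p ^ M₀ : ℕ) : ℤ) • Q = P :=
    ⟨x₀, by rw [natCast_zsmul]; exact hx₀⟩
  have hndiv : ¬ ∃ Q : (W.baseChange K).toAffine.Point, ((p ^ (M₀ + 1) : ℕ) : ℤ) • Q = P := by
    rintro ⟨Q, hQ⟩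
    exact hmax Q (by rw [← natCast_zsmul]; exact hQ)
  -- the prime-level certificate at this frame; Matar–Nekovář ⟹ STEP L′ (§35)
  obtain ⟨ℓ, d, hℓ, hcert⟩ := hCertW K Dt H.β ι hK hodd hlt hHN hLt H.dvd_sq_sub hc
  have hL' : (2 * padicValNat p (AddSubgroup.zmultiples P).index : ℤ) ≤
      padicValNat p (W.baseChange K).shaOrder + padicValNat p W.tamagawaProduct +
        padicValNat p Wd.tamagawaProduct + 2 * padicValRat p (Dt.c : ℚ) :=
    adjustedIndexBound_of_primeCertificate_of_matarNekovar hMN W hCM K hK h3 h4 hHN p hp2 hirr Dt H.β ι d₁ P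
      hPd hPinf hrank hiv hdiv hndiv d hℓ hcert Wd
  -- gen 2's Part 14 door: PUB + Conjecture A at the twist + STEP L′ at the datum
  exact missingLowerBoundAt_rankOne_additive_of_adjustedIndexBound_of_irr W p K Dt H ι P (hGZ _ W K) (hKo _ W K)
    hKatoI hGZK hmod hr hp2 hadd hj hirr hK hHN hP hμ hLt Wd Cd hWd (hA K Wd Cd hK hHN hLt hWd) (fun _ ↦ hL')

/-- **CLASS LEVEL, the SMALL-IMAGE rows of cell (G-ord, `e = 2`) ∩ `r_an = 1` with `p ∤ ∏c_ℓ(E)`, EVERY ODD `p`**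
(`E[p]` irreducible, `ρ̄_{E,p^n}` not onto for some `n`, non-CM; on `p ∣ ∏c` BSD predicts `M_∞ > 0`, so the prime-level
certificate is asked only off that corner): `Typed.MissingLowerBoundAt W p` from PUB (`hPub`, `hKatoI`, `hMN`, cite-only
`hMz hAU hC2` for Part 18a's Manin-good datum on `Irr` rows) and the DISPLAYED inputs `hPCert` (a prime-level
Kolyvagin certificate at every odd Manin-good frame with `d_K < −4` of every such row) and `hAsm` (Conjecture A at the
Heegner-field twists of such rows — gen 2's binder shape). Compare gen 2's
`cellGordTwo_missingLowerBoundAt_rankOne_of_smallImage_of_adjustedIndexBound_of_conjA` (input STEP L′ on the rows).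
[cite: MatarNekovar2019, Thm. 0.7 and §0.11] [cite: Kato2004Asterisque, Thm. 14.5 (3) (p. 236) and Prop. 14.16 (2)]
[cite: CoatesSujatha2005, statement (A)] [cite: EdixhovenManin1991, §1] [cite: Mazur1978, Cor. 4.1]
[cite: AbbesUllmo1996, Thm. A] [cite: Miller2011LMS, Def. 1.1] -/
theorem cellGordTwo_missingLowerBoundAt_rankOne_smallImage_of_primeCertificates
    (hPub : PublishedInputsAdditiveKoly)
    (hKatoI : Kato2004.rankZero_padicValNat_sha_add_padicValNat_tamagawa_le_of_additive_potGood_of_irreducible_of_fineSelmerDual_fg)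
    (hMN : MatarNekovar2019_card_sha_primary_baseChange_of_derivedPoint_not_divisible_of_irreducible)
    (hMz : mazur_not_dvd_maninConstant_of_odd)
    (hAU : abbesUllmo_not_dvd_maninConstant_of_not_dvd_level)
    (hC2 : cesnavicius_not_two_dvd_maninConstant_of_two_dvd_level)
    (hPCert : ∀ (W : WeierstrassCurve ℚ) [W.IsElliptic] [W.IsGloballyMinimal] (p : ℕ) [Fact p.Prime]
      [NeZero (W.conductorNorm ℤ)] (K : Type) [Field K] [NumberField K]
      (Dt : ModularParametrizationData W (W.conductorNorm ℤ)) (β : ℤ) (ι : K →+* ℂ),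
      W.analyticRank = 1 → N10.CellGordTwo W p → W.HasIrreducibleModPGaloisRep p →
      ¬ (∀ n : ℕ, W.HasSurjectiveModNGaloisRep (p ^ n : ℕ)) → ¬ p ∣ W.tamagawaProduct →
      IsImaginaryQuadratic K → Odd (NumberField.discr K) → NumberField.discr K < -4 →
      SatisfiesHeegnerHypothesis (W.conductorNorm ℤ) K →
      (W.quadraticTwist (NumberField.discr K : ℚ)).entireLFunction 1 ≠ 0 →
      (4 * (W.conductorNorm ℤ : ℤ)) ∣ β ^ 2 - NumberField.discr K → ¬ (p : ℤ) ∣ Dt.c →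
      ∃ (ℓ : ℕ) (d : KolyvaginHeegnerData Dt β ι ℓ), Zhang2014.IsKolyvaginPrime (W.conductorNorm ℤ) W K p ℓ ∧
        ¬ ∃ Q : (W.baseChange (ringClassField K ι ℓ)).toAffine.Point, (p : ℤ) • Q = d.derivedPoint)
    (hAsm : ∀ (W : WeierstrassCurve ℚ) [W.IsElliptic] [W.IsGloballyMinimal] (p : ℕ) [Fact p.Prime]
      (K : Type) [Field K] [NumberField K]
      (Wd : WeierstrassCurve ℚ) [Wd.IsElliptic] [Wd.IsGloballyMinimal] (Cd : VariableChange ℚ),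
      W.analyticRank = 1 → N10.CellGordTwo W p → W.HasIrreducibleModPGaloisRep p →
      ¬ (∀ n : ℕ, W.HasSurjectiveModNGaloisRep (p ^ n : ℕ)) →
      IsImaginaryQuadratic K → SatisfiesHeegnerHypothesis (W.conductorNorm ℤ) K →
      (W.quadraticTwist (NumberField.discr K : ℚ)).entireLFunction 1 ≠ 0 →
      Cd • W.quadraticTwist (NumberField.discr K : ℚ) = Wd →
      ∀ κ : ZpExtension ℚ p, κ.IsCyclotomic →
        ∃ (γ : Field.absoluteGaloisGroup ℚ) (D : Wd.FineSelmerDualData κ γ),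
          Module.Finite ℤ_[p] (RestrictScalars ℤ_[p] (IwasawaAlgebra p) D.X)) :
    ∀ (W : WeierstrassCurve ℚ) [W.IsElliptic] [W.IsGloballyMinimal] (p : ℕ) [Fact p.Prime],
      W.analyticRank = 1 → N10.CellGordTwo W p → ¬ W.HasCM → W.HasIrreducibleModPGaloisRep p →
      ¬ (∀ n : ℕ, W.HasSurjectiveModNGaloisRep (p ^ n : ℕ)) → ¬ p ∣ W.tamagawaProduct →
      Typed.MissingLowerBoundAt W p := by
  intro W _ _ p _ hr hc2 hCM hirr hns htam
  haveI : NeZero (W.conductorNorm ℤ) := ⟨(W.conductorNorm_pos_holds).ne'⟩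
  obtain ⟨hp2, hadd, hG⟩ : p ≠ 2 ∧ Addv W p ∧ TypeGOrd W p := ⟨hc2.1, hc2.2.1, hc2.2.2.1⟩
  have hj : 0 ≤ padicValRat p W.j := not_lt.mp (N10.not_potMult_of_typeGOrd W p hp2 hadd hG)
  have hD : ∃ Dt : ModularParametrizationData W (W.conductorNorm ℤ), ¬ (p : ℤ) ∣ Dt.c :=
    exists_modularParametrizationData_not_dvd_of_cellGordTwo_of_irr hPub.2.2.2.2.2.1 hMz hAU hC2 W p hc2 hirr
  exact missingLowerBoundAt_rankOne_additive_potGood_irr_of_primeCertificate hPub hKatoI hMN W p hCM hp2 hadd hj hr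
    hirr hD (fun K _ _ Dt β ι hK hodd hlt hHN hLt hβ hc ↦ hPCert W p K Dt β ι hr hc2 hirr hns htam hK hodd hlt hHN hLt hβ hc)
    (fun K _ _ Wd _ _ Cd hK hHN hLt hWd ↦ hAsm W p K Wd Cd hr hc2 hirr hns hK hHN hLt hWd)

/-! ### §37 The crux BY NAME on the certificate road (displayed: reducible rows ∪ the `p ∣ ∏c` small-image corner) -/

/-- **Crux `GordTwoRankOne` (item 19358) BY NAME on the Kolyvagin-index road, EVERY IRREDUCIBLE ROW, no Manin
rider, no STEP L′.** PUBLISHED binders: `hPub` (the sibling's conjunction), `hKatoT` (Kato, image ⊇ SL₂, tower-surjective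
rows), `hKatoI` (Kato, irreducible image, fine-Selmer reading), `hMN` (Matar–Nekovář), `hLLT` (CM rows, lane A),
cite-only `hMz hAU hC2` (Part 18a's Manin-good datum). DISPLAYED inputs: `hCert` — BSD-depth Kolyvagin certificates at
the odd Manin-good frames of the TOWER-SURJECTIVE rows (Part 17d/18a shape); `hPCert` — prime-level certificates at
the odd Manin-good frames of the SMALL-IMAGE rows (§36); `hAsm` — Conjecture A at the Heegner-field twists of the
small-image rows with `p ∤ ∏c_ℓ(E)`; `hRest` — the crux on the non-CM non-tower-surjective rows that are REDUCIBLE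
(X3♯(G-ord): lane A's Greenberg–Vatsal / A′ road) or have `p ∣ ∏c_ℓ(E)` (where BSD predicts `M_∞ = ord_p ∏c > 0` and no
depth-`M` structure theorem for irreducible image at an additive `p` is in the tree). Rows: CM → Li–Liu–Tian;
tower-surjective → Part 18a §31; irreducible, not tower-surjective, `p ∤ ∏c` → §36; the rest → displayed. An honest
split, not a closure; nothing booked; 19358 stays OPEN. [cite: MatarNekovar2019, Thm. 0.7 and §0.11]
[cite: McCallumLMS1991, §5 Cor. 5.6 (p. 310)] [cite: Kato2004Asterisque, Thm. 14.5 (3) (p. 236)]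
[cite: CoatesSujatha2005, statement (A)] [cite: LiLiuTian2024, Thm. 1.1 (i)] [cite: EdixhovenManin1991, §1]
[cite: Mazur1978, Cor. 4.1] [cite: AbbesUllmo1996, Thm. A] [cite: Miller2011LMS, Def. 1.1] -/
theorem gordTwoRankOne_of_certificates_of_primeCertificates_of_rest
    (hPub : PublishedInputsAdditiveKoly)
    (hKatoT : Kato2004.rankZero_padicValNat_sha_add_padicValNat_tamagawa_le_of_additive_potGood_of_imageContainsSL2)
    (hKatoI : Kato2004.rankZero_padicValNat_sha_add_padicValNat_tamagawa_le_of_additive_potGood_of_irreducible_of_fineSelmerDual_fg)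
    (hMN : MatarNekovar2019_card_sha_primary_baseChange_of_derivedPoint_not_divisible_of_irreducible)
    (hLLT : LiLiuTian2024.thm11_bsdp_of_cm_rank_one)
    (hMz : mazur_not_dvd_maninConstant_of_odd)
    (hAU : abbesUllmo_not_dvd_maninConstant_of_not_dvd_level)
    (hC2 : cesnavicius_not_two_dvd_maninConstant_of_two_dvd_level)
    (hCert : ∀ (W : WeierstrassCurve ℚ) [W.IsElliptic] [W.IsGloballyMinimal] (p : ℕ) [Fact p.Prime]
      [NeZero (W.conductorNorm ℤ)] (K : Type) [Field K] [NumberField K]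
      (Dt : ModularParametrizationData W (W.conductorNorm ℤ)) (β : ℤ) (ι : K →+* ℂ),
      W.analyticRank = 1 → N10.CellGordTwo W p → (∀ m : ℕ, W.HasSurjectiveModNGaloisRep (p ^ m : ℕ)) →
      IsImaginaryQuadratic K → Odd (NumberField.discr K) →
      SatisfiesHeegnerHypothesis (W.conductorNorm ℤ) K →
      (W.quadraticTwist (NumberField.discr K : ℚ)).entireLFunction 1 ≠ 0 →
      (4 * (W.conductorNorm ℤ : ℤ)) ∣ β ^ 2 - NumberField.discr K → ¬ (p : ℤ) ∣ Dt.c →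
      ∃ M : ℕ, M ≤ padicValNat p W.tamagawaProduct ∧ Three.Koly.CertificateAt Dt β ι p M)
    (hPCert : ∀ (W : WeierstrassCurve ℚ) [W.IsElliptic] [W.IsGloballyMinimal] (p : ℕ) [Fact p.Prime]
      [NeZero (W.conductorNorm ℤ)] (K : Type) [Field K] [NumberField K]
      (Dt : ModularParametrizationData W (W.conductorNorm ℤ)) (β : ℤ) (ι : K →+* ℂ),
      W.analyticRank = 1 → N10.CellGordTwo W p → W.HasIrreducibleModPGaloisRep p →
      ¬ (∀ n : ℕ, W.HasSurjectiveModNGaloisRep (p ^ n : ℕ)) → ¬ p ∣ W.tamagawaProduct →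
      IsImaginaryQuadratic K → Odd (NumberField.discr K) → NumberField.discr K < -4 →
      SatisfiesHeegnerHypothesis (W.conductorNorm ℤ) K →
      (W.quadraticTwist (NumberField.discr K : ℚ)).entireLFunction 1 ≠ 0 →
      (4 * (W.conductorNorm ℤ : ℤ)) ∣ β ^ 2 - NumberField.discr K → ¬ (p : ℤ) ∣ Dt.c →
      ∃ (ℓ : ℕ) (d : KolyvaginHeegnerData Dt β ι ℓ), Zhang2014.IsKolyvaginPrime (W.conductorNorm ℤ) W K p ℓ ∧
        ¬ ∃ Q : (W.baseChange (ringClassField K ι ℓ)).toAffine.Point, (p : ℤ) • Q = d.derivedPoint)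
    (hAsm : ∀ (W : WeierstrassCurve ℚ) [W.IsElliptic] [W.IsGloballyMinimal] (p : ℕ) [Fact p.Prime]
      (K : Type) [Field K] [NumberField K]
      (Wd : WeierstrassCurve ℚ) [Wd.IsElliptic] [Wd.IsGloballyMinimal] (Cd : VariableChange ℚ),
      W.analyticRank = 1 → N10.CellGordTwo W p → W.HasIrreducibleModPGaloisRep p →
      ¬ (∀ n : ℕ, W.HasSurjectiveModNGaloisRep (p ^ n : ℕ)) →
      IsImaginaryQuadratic K → SatisfiesHeegnerHypothesis (W.conductorNorm ℤ) K →
      (W.quadraticTwist (NumberField.discr K : ℚ)).entireLFunction 1 ≠ 0 →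
      Cd • W.quadraticTwist (NumberField.discr K : ℚ) = Wd →
      ∀ κ : ZpExtension ℚ p, κ.IsCyclotomic →
        ∃ (γ : Field.absoluteGaloisGroup ℚ) (D : Wd.FineSelmerDualData κ γ),
          Module.Finite ℤ_[p] (RestrictScalars ℤ_[p] (IwasawaAlgebra p) D.X))
    (hRest : ∀ (W : WeierstrassCurve ℚ) [W.IsElliptic] [W.IsGloballyMinimal] (p : ℕ) [Fact p.Prime],
      W.analyticRank = 1 → N10.CellGordTwo W p → ¬ W.HasCM → ¬ (∀ n : ℕ, W.HasSurjectiveModNGaloisRep (p ^ n : ℕ)) →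
      ¬ (W.HasIrreducibleModPGaloisRep p ∧ ¬ p ∣ W.tamagawaProduct) → Typed.MissingLowerBoundAt W p) :
    Summit.BirchSwinnertonDyer.BirchSwinnertonDyer.Theses.AdditiveBranchIMC.GordTwoRankOne := by
  intro W _ _ p _ hr hc2
  by_cases hcm : W.HasCM
  · exact gordTwoRankOne_cm_of_liLiuTian hLLT W p hr hc2 hcm
  by_cases hsurj : ∀ n : ℕ, W.HasSurjectiveModNGaloisRep (p ^ n : ℕ)
  · exact cellGordTwo_missingLowerBoundAt_rankOne_towerSurj_of_certificates_pub hPub hKatoT hMz hAU hC2 hCert W p hr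
      hc2 hsurj
  by_cases hsm : W.HasIrreducibleModPGaloisRep p ∧ ¬ p ∣ W.tamagawaProduct
  · exact cellGordTwo_missingLowerBoundAt_rankOne_smallImage_of_primeCertificates hPub hKatoI hMN hMz hAU hC2 hPCert
      hAsm W p hr hc2 hcm hsm.1 hsurj hsm.2
  · exact hRest W p hr hc2 hcm hsurj hsm

end Summit.BirchSwinnertonDyer.BirchSwinnertonDyer.Theorems.AdditiveBranchIMCGordTwoRankOne.HeegnerKolyvagin

end
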